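import Literature.MathematicalPhysics.QuantumFieldTheory.CubicalChainsPairing
import HarnessLib

/-!
# Convolution of lattice tensors with a finitely supported scalar kernel

Support file (module "P4a") for the lattice potential theory of the four-dimensional `U(1)` gauge
theory (proof programme of the named fact
`Literature.MathematicalPhysics.QuantumFieldTheory.FrohlichSpencerU1PerimeterLawD4`;
Fröhlich–Spencer 1982 §2.5, §2.7, (2.88)). The test 3-chain in the variational bound for the
Coulomb energy `(ε_Λ, ε_Λ)` of a Wilson-loop sheet `σ` is `f = d₂ (p ∗ σ)` with `p` a finitely
supported real kernel (`LatticeGreenKernel`); here we set up the convolution `p ∗ ·` of real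
lattice tensors with a scalar kernel read on a finite set `S ⊇ supp p`, and prove the lattice-side
bookkeeping. Everything is proved; no named fact is introduced.

* `conv S p F`, `conv₁`, `conv₂` (scalar / 1-tensor / 2-tensor convolution `∑_{z∈S} p(z) F(y-z)`);
  finite support (`hasFiniteSupport_conv₂`, …), alternation (`isAltR₂_conv₂`);
* **translation invariance**: `div₂_conv₂ : ∂(p ∗ M) = p ∗ ∂M`, `negLap₂_conv₂ : -Δ(p ∗ M) = p ∗ (-ΔM)`
  (with the scalar Laplacian `negLap₀` and `negLap₂_apply`);
* `div₃_d₂_eq : ∂(d₂ M) = -ΔM - d₁(∂M)` (the Hodge identity of `CubicalChainsHodge`, rearranged) and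
  the resulting formula `sub_div₃_d₂_conv₂ :
  σ - ∂(d₂(p ∗ σ)) = (σ - p ∗ (-Δσ)) + d₁ (p ∗ ∂σ)`;
* `isAltR₃_d₂` (the coboundary of an alternating 2-tensor is totally alternating);
* `pair₂` as a positive quadratic form: `pair₂_self_nonneg`, `pair₂_self_eq`,
  `pair₂_add_self_le : ‖A + B‖² ≤ 2‖A‖² + 2‖B‖²`.

## References

* J. Fröhlich, T. Spencer, Comm. Math. Phys. 83 (1982) 411–454, §2.3 (2.14)–(2.16), §2.5, §2.10 (2.88).
  [FrohlichSpencerCMP1982]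
-/

noncomputable section

open Finset Function Literature.Probability.LatticeModels

namespace Literature.MathematicalPhysics.QuantumFieldTheory

namespace LatticeChain

open LatticeForm (e d₁ d₂)

variable {d : ℕ}

/-! ### Convolutions -/

/-- Scalar convolution with a kernel `p` read on the finite set `S`: `(p ∗ F)(y) = ∑_{z∈S} p(z) F(y-z)`.
[folklore] -/
def conv (S : Finset (Site d)) (p : Site d → ℝ) (F : Site d → ℝ) : Site d → ℝ :=
  fun y => ∑ z ∈ S, p z * F (y - z)

/-- Convolution of a 1-tensor with a scalar kernel (componentwise). [folklore] -/
def conv₁ (S : Finset (Site d)) (p : Site d → ℝ) (φ : Site d → Fin d → ℝ) : Site d → Fin d → ℝ :=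
  fun y k => ∑ z ∈ S, p z * φ (y - z) k

/-- Convolution of a 2-tensor with a scalar kernel (componentwise). [folklore] -/
def conv₂ (S : Finset (Site d)) (p : Site d → ℝ) (M : Site d → Fin d → Fin d → ℝ) :
    Site d → Fin d → Fin d → ℝ :=
  fun y k l => ∑ z ∈ S, p z * M (y - z) k l

/-- Components of `conv₂` are scalar convolutions of the components. [folklore] -/
theorem conv₂_apply (S : Finset (Site d)) (p : Site d → ℝ) (M : Site d → Fin d → Fin d → ℝ)
    (y : Site d) (k l : Fin d) : conv₂ S p M y k l = conv S p (fun y => M y k l) y := rfl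

/-- Components of `conv₁` are scalar convolutions of the components. [folklore] -/
theorem conv₁_apply (S : Finset (Site d)) (p : Site d → ℝ) (φ : Site d → Fin d → ℝ)
    (y : Site d) (k : Fin d) : conv₁ S p φ y k = conv S p (fun y => φ y k) y := rfl

/-- Convolution commutes with translations of the argument. [folklore] -/
theorem conv_comp_add (S : Finset (Site d)) (p : Site d → ℝ) (F : Site d → ℝ) (a y : Site d) :
    conv S p (fun y => F (y + a)) y = conv S p F (y + a) := by
  simp only [conv, add_sub_right_comm]

/-- Convolution commutes with backward translations of the argument. [folklore] -/
theorem conv_comp_sub (S : Finset (Site d)) (p : Site d → ℝ) (F : Site d → ℝ) (a y : Site d) :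
    conv S p (fun y => F (y - a)) y = conv S p F (y - a) := by
  simp only [conv, sub_right_comm _ _ a]

/-- Convolution is additive. [folklore] -/
theorem conv_add (S : Finset (Site d)) (p : Site d → ℝ) (F G : Site d → ℝ) (y : Site d) :
    conv S p (fun y => F y + G y) y = conv S p F y + conv S p G y := by
  simp only [conv, mul_add, Finset.sum_add_distrib]

/-- Convolution is subtractive. [folklore] -/
theorem conv_sub (S : Finset (Site d)) (p : Site d → ℝ) (F G : Site d → ℝ) (y : Site d) :
    conv S p (fun y => F y - G y) y = conv S p F y - conv S p G y := by
  simp only [conv, mul_sub, Finset.sum_sub_distrib]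

/-- Convolution commutes with finite sums. [folklore] -/
theorem conv_finset_sum {ι : Type*} (T : Finset ι) (S : Finset (Site d)) (p : Site d → ℝ)
    (F : ι → Site d → ℝ) (y : Site d) :
    conv S p (fun y => ∑ i ∈ T, F i y) y = ∑ i ∈ T, conv S p (F i) y := by
  simp only [conv, Finset.mul_sum]
  rw [Finset.sum_comm]

/-! ### Finite support and alternation -/

/-- The convolution of a finitely supported 2-tensor is finitely supported. [folklore] -/
theorem hasFiniteSupport_conv₂ (S : Finset (Site d)) (p : Site d → ℝ) {M : Site d → Fin d → Fin d → ℝ}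
    (hM : HasFiniteSupport M) : HasFiniteSupport (conv₂ S p M) := by
  refine (Set.Finite.biUnion S.finite_toSet fun z _ => hasFiniteSupport_comp_sub hM z).subset
    fun y hy => ?_
  simp only [Function.mem_support, ne_eq, Set.mem_iUnion, Finset.mem_coe, exists_prop] at hy ⊢
  by_contra hcon
  push Not at hcon
  apply hy
  funext k l
  simp only [conv₂, Pi.zero_apply]
  exact Finset.sum_eq_zero fun z hz => by rw [hcon z hz]; simp

/-- The convolution of a finitely supported 1-tensor is finitely supported. [folklore] -/
theorem hasFiniteSupport_conv₁ (S : Finset (Site d)) (p : Site d → ℝ) {φ : Site d → Fin d → ℝ}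
    (hφ : HasFiniteSupport φ) : HasFiniteSupport (conv₁ S p φ) := by
  refine (Set.Finite.biUnion S.finite_toSet fun z _ => hasFiniteSupport_comp_sub hφ z).subset
    fun y hy => ?_
  simp only [Function.mem_support, ne_eq, Set.mem_iUnion, Finset.mem_coe, exists_prop] at hy ⊢
  by_contra hcon
  push Not at hcon
  apply hy
  funext k
  simp only [conv₁, Pi.zero_apply]
  exact Finset.sum_eq_zero fun z hz => by rw [hcon z hz]; simp

/-- The convolution of a finitely supported scalar family is finitely supported. [folklore] -/
theorem hasFiniteSupport_conv (S : Finset (Site d)) (p : Site d → ℝ) {F : Site d → ℝ}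
    (hF : HasFiniteSupport F) : HasFiniteSupport (conv S p F) := by
  refine (Set.Finite.biUnion S.finite_toSet fun z _ => hasFiniteSupport_comp_sub hF z).subset
    fun y hy => ?_
  simp only [Function.mem_support, ne_eq, Set.mem_iUnion, Finset.mem_coe, exists_prop] at hy ⊢
  by_contra hcon
  push Not at hcon
  apply hy
  simp only [conv]
  exact Finset.sum_eq_zero fun z hz => by rw [hcon z hz]; simp

/-- Convolution preserves alternation. [folklore] -/
theorem isAltR₂_conv₂ (S : Finset (Site d)) (p : Site d → ℝ) {M : Site d → Fin d → Fin d → ℝ}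
    (hM : IsAltR₂ M) : IsAltR₂ (conv₂ S p M) := fun y i j => by
  simp only [conv₂, hM _ i j, mul_neg, Finset.sum_neg_distrib]

/-- The coboundary of an alternating 2-tensor is totally alternating. [folklore] -/
theorem isAltR₃_d₂ {M : Site d → Fin d → Fin d → ℝ} (hM : IsAltR₂ M) : IsAltR₃ (d₂ M) := by
  constructor
  · intro y i j k
    simp only [LatticeForm.d₂]
    rw [hM y i j, hM (y + e k) i j]
    ring
  · intro y i j k
    simp only [LatticeForm.d₂]
    rw [hM y j k, hM (y + e i) j k]
    ring

/-! ### Translation invariance: convolution commutes with `∂` and `-Δ` -/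

/-- `∂(p ∗ M) = p ∗ ∂M`. [folklore] -/
theorem div₂_conv₂ (S : Finset (Site d)) (p : Site d → ℝ) (M : Site d → Fin d → Fin d → ℝ) :
    div₂ (conv₂ S p M) = conv₁ S p (div₂ M) := by
  funext y k
  simp only [div₂, conv₂, conv₁, Finset.mul_sum, mul_sub, Finset.sum_sub_distrib]
  rw [Finset.sum_comm, Finset.sum_comm (s := Finset.univ) (t := S)]
  congr 1
  refine Finset.sum_congr rfl fun z _ => Finset.sum_congr rfl fun j _ => ?_
  rw [sub_right_comm]

/-- The scalar lattice Laplacian `(-ΔF)(y) = ∑ᵢ ((F y - F (y+eᵢ)) + (F y - F (y-eᵢ)))`. [folklore] -/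
def negLap₀ (F : Site d → ℝ) : Site d → ℝ :=
  fun y => ∑ i, ((F y - F (y + e i)) + (F y - F (y - e i)))

/-- `negLap₂` acts componentwise as `negLap₀`. [folklore] -/
theorem negLap₂_apply (M : Site d → Fin d → Fin d → ℝ) (y : Site d) (k l : Fin d) :
    negLap₂ M y k l = negLap₀ (fun y => M y k l) y := rfl

/-- `-Δ(p ∗ F) = p ∗ (-ΔF)` for scalars. [folklore] -/
theorem negLap₀_conv (S : Finset (Site d)) (p : Site d → ℝ) (F : Site d → ℝ) (y : Site d) :
    negLap₀ (conv S p F) y = conv S p (negLap₀ F) y := by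
  simp only [negLap₀, conv, Finset.mul_sum, mul_add, mul_sub, Finset.sum_add_distrib,
    Finset.sum_sub_distrib]
  rw [Finset.sum_comm (s := S) (t := Finset.univ) (f := fun z i => p z * F (y - z + e i)),
    Finset.sum_comm (s := S) (t := Finset.univ) (f := fun z i => p z * F (y - z - e i)),
    Finset.sum_comm (s := S) (t := Finset.univ) (f := fun z i => p z * F (y - z))]
  simp only [add_sub_right_comm y _ _, sub_right_comm y _ (e _)]

/-- `-Δ(p ∗ M) = p ∗ (-ΔM)` for 2-tensors. [folklore] -/
theorem negLap₂_conv₂ (S : Finset (Site d)) (p : Site d → ℝ) (M : Site d → Fin d → Fin d → ℝ) :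
    negLap₂ (conv₂ S p M) = conv₂ S p (negLap₂ M) := by
  funext y k l
  rw [negLap₂_apply, conv₂_apply]
  have h : (fun y => conv₂ S p M y k l) = conv S p fun y => M y k l := rfl
  rw [h, negLap₀_conv]
  rfl

/-! ### The Hodge identity, rearranged -/

/-- `∂(d₂ M) = -ΔM - d₁(∂M)`. [cite: FrohlichSpencerCMP1982, §2.3 (2.16)] -/
theorem div₃_d₂_eq (M : Site d → Fin d → Fin d → ℝ) : div₃ (d₂ M) = negLap₂ M - d₁ (div₂ M) :=
  eq_sub_of_add_eq (div₃_d₂_add_d₁_div₂ M)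

/-- **The error chain of the convolution test chain**: with `f = d₂ (p ∗ σ)`,
`σ - ∂f = (σ - p ∗ (-Δσ)) + d₁ (p ∗ ∂σ)`. [folklore] -/
theorem sub_div₃_d₂_conv₂ (S : Finset (Site d)) (p : Site d → ℝ) (σ : Site d → Fin d → Fin d → ℝ) :
    σ - div₃ (d₂ (conv₂ S p σ)) = (σ - conv₂ S p (negLap₂ σ)) + d₁ (conv₁ S p (div₂ σ)) := by
  rw [div₃_d₂_eq, negLap₂_conv₂, div₂_conv₂]
  abel

/-! ### `pair₂` as a positive quadratic form -/

/-- `⟪M, M⟫₂ ≥ 0`. [folklore] -/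
theorem pair₂_self_nonneg (M : Site d → Fin d → Fin d → ℝ) : 0 ≤ pair₂ M M := by
  unfold pair₂
  refine mul_nonneg (by norm_num) (tsum_nonneg fun y => ?_)
  exact Finset.sum_nonneg fun k _ => Finset.sum_nonneg fun l _ => mul_self_nonneg _

/-- `⟪A + B, A + B⟫₂ ≤ 2⟪A, A⟫₂ + 2⟪B, B⟫₂` for finitely supported 2-tensors. [folklore] -/
theorem pair₂_add_self_le {A B : Site d → Fin d → Fin d → ℝ} (hA : HasFiniteSupport A)
    (hB : HasFiniteSupport B) :
    pair₂ (A + B) (A + B) ≤ 2 * pair₂ A A + 2 * pair₂ B B := by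
  have h1 : pair₂ (A + B) (A + B) = pair₂ A A + 2 * pair₂ A B + pair₂ B B := by
    rw [pair₂_add_right (hA.add hB), pair₂_comm (A + B) A, pair₂_comm (A + B) B,
      pair₂_add_right hA, pair₂_add_right hB, pair₂_comm B A]
    ring
  have h2 : pair₂ (A - B) (A - B) = pair₂ A A - 2 * pair₂ A B + pair₂ B B := by
    rw [pair₂_sub_right (hA.sub hB), pair₂_comm (A - B) A, pair₂_comm (A - B) B,
      pair₂_sub_right hA, pair₂_sub_right hB, pair₂_comm B A]
    ring
  have h3 := pair₂_self_nonneg (A - B)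
  linarith

end LatticeChain

end Literature.MathematicalPhysics.QuantumFieldTheory
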